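import Summits.QuantumFields.GaugeBoot.Rows.AggBindKit4
import HarnessLib

/-!
# Gauge-boot: binding kit for aggregated rows in `D = 4` — RANGE-RESTRICTED walks (chunking of `AggBind4.tsWalk4` / `rnWalk` / `colOK`)

Cell `pub-gaugeboot` (HOME `run/shared/lean/pub/pub-gaugeboot/`), seat lean1 (torus bindings of the kz-L2-rp-4D family, rows C91–C105 /
C123–C127).

HONEST FRAMING (page 1 of every file of this cell): certified bounds on lattice expectations at STATED coupling,
gauge group, dimension and torus size; NOT a mass gap, NOT a continuum limit, NOT a string tension, NOT large `N`.
The venture is explicitly NOT Yang–Mills-summit-bearing (barriers `FixedCouplingUltralocality`,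
`PerturbativeInvisibility`).

The one-pass kernel walk `AggBind4.tsWalk4` over lean2's ≈ 10⁴ coded terms of a kz-L2-rp-4D aggregated row (three bignum checks per
term against 60-bit label codes and ≈ 70-bit numerators) exceeds the kernel's per-theorem budget on the farm.  `tsWalk4R a b` makes the
same three checks only at positions `a ≤ j < b` (positions outside the range are skipped with two small comparisons), so the walk can
be certified in several `decide` chunks; `tsWalk4R_merge` glues adjacent ranges and `tsWalk4_of_R` recovers `tsWalk4` from a range
covering the whole list.  The same is done for the two cheaper checks, for margin: `rnWalkR` (lean3's numerator list against the
tabulated `rn`, merged by `rnWalkR_merge`, recovered by `rnWalk_of_R`) and `colOKvR` / `colOKjR` (the two halves of `colOK`, merged by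
`colOKvR_merge` / `colOKjR_merge`, recovered by `colOK_of_R`).  [folklore]
-/

namespace Summit.QuantumFields.GaugeBoot

namespace AggBind4

/-- Range-restricted walk over lean2's coded terms from position `j`: AT POSITIONS `a ≤ j < b` ONLY, the code is that of column
`col j < n` and `z · RD = rn (col j) · M` (the checks of `tsWalk4`); other positions are skipped. -/
def tsWalk4R (n : ℕ) (code : ℕ → ℕ) (rn : ℕ → ℤ) (col : ℕ → ℕ) (M RD a b : ℕ) : ℕ → List (ℕ × ℤ) → Bool
  | _, [] => true
  | j, t :: l => (decide (j < a) || decide (b ≤ j) ||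
      (decide (col j < n) && decide (t.1 = code (col j)) && decide (t.2 * (RD : ℤ) = rn (col j) * (M : ℤ)))) &&
      tsWalk4R n code rn col M RD a b (j + 1) l

/-- Adjacent ranges merge: `[a, m)` and `[m, b)` give `[a, b)`. -/
theorem tsWalk4R_merge (n : ℕ) (code : ℕ → ℕ) (rn : ℕ → ℤ) (col : ℕ → ℕ) (M RD a m b : ℕ) :
    ∀ (j : ℕ) (l : List (ℕ × ℤ)),
      tsWalk4R n code rn col M RD a m j l = true → tsWalk4R n code rn col M RD m b j l = true →
      tsWalk4R n code rn col M RD a b j l = true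
  | _, [], _, _ => rfl
  | j, t :: l, h₁, h₂ => by
    simp only [tsWalk4R, Bool.and_eq_true, Bool.or_eq_true, decide_eq_true_eq] at h₁ h₂ ⊢
    refine ⟨?_, tsWalk4R_merge n code rn col M RD a m b (j + 1) l h₁.2 h₂.2⟩
    rcases h₁.1 with (hlt | hge) | hc
    · exact Or.inl (Or.inl hlt)
    · rcases h₂.1 with (hlt' | hge') | hc'
      · exact absurd hlt' (Nat.not_lt.mpr hge)
      · exact Or.inl (Or.inr hge')
      · exact Or.inr hc'
    · exact Or.inr hc

/-- A range covering every position of the list recovers the unrestricted walk `tsWalk4`. -/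
theorem tsWalk4_of_R (n : ℕ) (code : ℕ → ℕ) (rn : ℕ → ℤ) (col : ℕ → ℕ) (M RD a b : ℕ) :
    ∀ (j : ℕ) (l : List (ℕ × ℤ)), a ≤ j → j + l.length ≤ b →
      tsWalk4R n code rn col M RD a b j l = true → tsWalk4 n code rn col M RD j l = true
  | _, [], _, _, _ => rfl
  | j, t :: l, ha, hb, h => by
    simp only [tsWalk4R, tsWalk4, Bool.and_eq_true, Bool.or_eq_true, decide_eq_true_eq, List.length_cons] at h hb ⊢
    refine ⟨?_, tsWalk4_of_R n code rn col M RD a b (j + 1) l (by omega) (by omega) h.2⟩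
    rcases h.1 with (hlt | hge) | hc
    · omega
    · omega
    · exact hc

/-- Range-restricted form of `rnWalk`: lean3's numerator list from column `v` agrees with `rn` AT COLUMNS `a ≤ v < b` (others skipped). -/
def rnWalkR (rn : ℕ → ℤ) (a b : ℕ) : ℕ → List ℤ → Bool
  | _, [] => true
  | v, z :: l => (decide (v < a) || decide (b ≤ v) || decide (z = rn v)) && rnWalkR rn a b (v + 1) l

/-- Adjacent ranges merge. -/
theorem rnWalkR_merge (rn : ℕ → ℤ) (a m b : ℕ) : ∀ (v : ℕ) (l : List ℤ),
    rnWalkR rn a m v l = true → rnWalkR rn m b v l = true → rnWalkR rn a b v l = true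
  | _, [], _, _ => rfl
  | v, z :: l, h₁, h₂ => by
    simp only [rnWalkR, Bool.and_eq_true, Bool.or_eq_true, decide_eq_true_eq] at h₁ h₂ ⊢
    refine ⟨?_, rnWalkR_merge rn a m b (v + 1) l h₁.2 h₂.2⟩
    rcases h₁.1 with (hlt | hge) | hc
    · exact Or.inl (Or.inl hlt)
    · rcases h₂.1 with (hlt' | hge') | hc'
      · exact absurd hlt' (Nat.not_lt.mpr hge)
      · exact Or.inl (Or.inr hge')
      · exact Or.inr hc'
    · exact Or.inr hc

/-- A covering range recovers `rnWalk`. -/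
theorem rnWalk_of_R (rn : ℕ → ℤ) (a b : ℕ) : ∀ (v : ℕ) (l : List ℤ), a ≤ v → v + l.length ≤ b →
    rnWalkR rn a b v l = true → rnWalk rn v l = true
  | _, [], _, _, _ => rfl
  | v, z :: l, ha, hb, h => by
    simp only [rnWalkR, rnWalk, Bool.and_eq_true, Bool.or_eq_true, decide_eq_true_eq, List.length_cons] at h hb ⊢
    refine ⟨?_, rnWalk_of_R rn a b (v + 1) l (by omega) (by omega) h.2⟩
    rcases h.1 with (hlt | hge) | hc
    · omega
    · omega
    · exact hc

/-- Range-restricted first half of `colOK`: AT COLUMNS `a ≤ v < b`, a column with a non-zero numerator is hit by a term. -/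
def colOKvR (n m : ℕ) (rn : ℕ → ℤ) (col pos : ℕ → ℕ) (a b : ℕ) : Bool :=
  (List.range n).all fun v => decide (v < a) || decide (b ≤ v) ||
    (decide (rn v = 0) || (decide (pos v < m) && decide (col (pos v) = v)))

/-- Range-restricted second half of `colOK`: AT TERMS `a ≤ j < b`, `pos (col j) = j`. -/
def colOKjR (m : ℕ) (col pos : ℕ → ℕ) (a b : ℕ) : Bool :=
  (List.range m).all fun j => decide (j < a) || decide (b ≤ j) || decide (pos (col j) = j)

/-- Adjacent ranges merge (columns). -/
theorem colOKvR_merge (n m : ℕ) (rn : ℕ → ℤ) (col pos : ℕ → ℕ) (a k b : ℕ)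
    (h₁ : colOKvR n m rn col pos a k = true) (h₂ : colOKvR n m rn col pos k b = true) : colOKvR n m rn col pos a b = true := by
  simp only [colOKvR, List.all_eq_true, Bool.or_eq_true, Bool.and_eq_true, decide_eq_true_eq] at h₁ h₂ ⊢
  intro v hv
  rcases h₁ v hv with (hlt | hge) | hc
  · exact Or.inl (Or.inl hlt)
  · rcases h₂ v hv with (hlt' | hge') | hc'
    · exact absurd hlt' (Nat.not_lt.mpr hge)
    · exact Or.inl (Or.inr hge')
    · exact Or.inr hc'
  · exact Or.inr hc

/-- Adjacent ranges merge (terms). -/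
theorem colOKjR_merge (m : ℕ) (col pos : ℕ → ℕ) (a k b : ℕ)
    (h₁ : colOKjR m col pos a k = true) (h₂ : colOKjR m col pos k b = true) : colOKjR m col pos a b = true := by
  simp only [colOKjR, List.all_eq_true, Bool.or_eq_true, decide_eq_true_eq] at h₁ h₂ ⊢
  intro j hj
  rcases h₁ j hj with (hlt | hge) | hc
  · exact Or.inl (Or.inl hlt)
  · rcases h₂ j hj with (hlt' | hge') | hc'
    · exact absurd hlt' (Nat.not_lt.mpr hge)
    · exact Or.inl (Or.inr hge')
    · exact Or.inr hc'
  · exact Or.inr hc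

/-- Covering ranges for both halves recover `colOK`. -/
theorem colOK_of_R (n m : ℕ) (rn : ℕ → ℤ) (col pos : ℕ → ℕ) (b b' : ℕ) (hb : n ≤ b) (hb' : m ≤ b')
    (h₁ : colOKvR n m rn col pos 0 b = true) (h₂ : colOKjR m col pos 0 b' = true) : colOK n m rn col pos = true := by
  simp only [colOKvR, colOKjR, colOK, List.all_eq_true, Bool.or_eq_true, Bool.and_eq_true, decide_eq_true_eq,
    List.mem_range] at h₁ h₂ ⊢
  refine ⟨fun v hv => ?_, fun j hj => ?_⟩
  · rcases h₁ v hv with (hlt | hge) | hc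
    · omega
    · omega
    · exact hc
  · rcases h₂ j hj with (hlt | hge) | hc
    · omega
    · omega
    · exact hc

end AggBind4

end Summit.QuantumFields.GaugeBoot
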